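import Summits.QuantumFields.YangMills.Theorems.BalabanUVNodesN15CurvedCubeTransplantGradient
import Summits.QuantumFields.YangMills.Theorems.BalabanUVNodesN15TwoSpacingGluingCubes
import HarnessLib

/-!
# Route «BalabanUVNodes» (cluster K4 «SpineRates»), Track-A DAG node N15 = NE2, BACKGROUND LAYER — THE CUT DERIVATIVE ROWS OF TRANSPLANTED CUBE OPERATORS AT TWO SPACINGS:
# the η-defect `𝔇(M_{h′}∇′(ε′T′ρ′), M_h∇(εTρ))` is the transplant of the CUBE defect `𝔇(∇′_□T′, ∇_□T)` behind the fine cut plus the FIT of the cuts times the transplanted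
# coarse derivative entry (EXACT), and its letter `1_{W′}(y)1_W(y′)·K_𝔇 + o(y)·1_W(y)1_W(y′)·K₁` — the `hDG`-type rows of the two-grid gluing for cube operators typed on their
# own lattices

Cell `pub-ymgap`, WIDTH SEAT `pub-ymgap-dag-n15-w2` (director-ym №197 ∕ HUMAN RULING D-0149), generation 3, file 6 (two-grid sequel of file 2 = dag-n15-w3 g3's located piece
(c)).  `bears_on: R4∕N15 · K3⁷ SpineGivenEndpointR13SepCoPH (stmt-QuantumFields-20544)`.  Filed `--kind proof --supports stmt-QuantumFields-20544 --as helper` — COUNT-NEUTRAL;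
theorems only (0 `def`, 0 `sorry`).  Imports BY NAME this seat's file 2 `…N15CurvedCubeTransplantGradient` (p606335: `mulOp_comp_fgrad∕bgrad_comp_transplant`,
`hasMaj_mulOp_comp_of_abs_le_one'`; through it dag-n15-w3's file 11: `idef_transplant`, `hasMaj_extend_comp_restrict`, `hasMaj_transplant`, `windowInd`) and dag-n15-c's FILE 45
`…N15TwoSpacingGluingCubes` (`Gluing.hasMaj_diag_comp`); lit `T4EtaRateDefect.idef`, `idef_comp`, `T4EtaRateCoeffDefect.hasMaj_idef_mulOp`, `diagK`; nothing re-declared.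

WHY.  dag-n15-c's two-grid gluing (`hasMaj_idef_glued_of_cubes_in` FILE 57, `hasMaj_idef_glued_of_cutRows` FILE 63) displays, per cube, the η-DEFECT rows of the CUT cube objects
and of their derivative entries between the fine and the coarse global lattices ([Balaban1985BackgroundPropagators] Thm 3.1 (3.42)–(3.43) pp. 397–398: the η-rate of `G(U)` AND of
`∇G(U)`; [Balaban1984PropagatorsII] (2.133) p. 247).  When the cube operators are typed on their own lattices and read on the global ones through the transplant, file 11 §2
(`idef_transplant`) moves the defect of the operators themselves; file 2 (cut editions) identifies the cut global derivative of a transplant with the transplant of the cube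
derivative.  THIS FILE composes the two with the lit's Leibniz rule `idef_comp` and the coefficient-defect letter `hasMaj_idef_mulOp`: the cut derivative rows at two spacings are the
transplanted cube defect of the derivative pair plus the fit of the two cuts against the transplanted coarse derivative entry — exact identity and letter.

WHAT: §1 ★★ `idef_mulOp_fgrad_transplant` (EXACT: `𝔇(M_{h′}∇′_{E_f}(ε_fT′ρ_f), M_h∇_E(εTρ)) = M_{h′} ∘ ε_f𝔇_□(∇′_{E_f′}T′, ∇_{E′}T)ρ + 𝔇(M_{h′}, M_h) ∘ ε(∇_{E′}T)ρ` under the cut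
hypotheses of file 2 on both grids and file 11's window∕chart compatibilities), ★★ `idef_mulOp_bgrad_transplant` (backward); §2 ★★ `hasMaj_idef_mulOp_fgrad_transplant` ∕ ★★
`hasMaj_idef_mulOp_bgrad_transplant` (the letter `1_{W_f}(y)·1_W(y′)·K_𝔇(y, y′) + o(y)·1_W(y)·1_W(y′)·K₁(y, y′)` from the cube defect letter `K_𝔇` of the derivative pair, the cube
entry-1 letter `K₁`, the fit `|h′(x′) − h(πx′)| ≤ o(B(πx′))` of the cuts and `|h′| ≤ 1`).

HONEST FRAMING ∕ LIMITS.  Finite-lattice bookkeeping (Leibniz for η-defects + file 2 + file 11 §2); the fine global blocks are the coarse ones read through `π` (`B_f = B ∘ π`, the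
lineage's convention); the window∕chart geometry at two spacings (`W_f = π⁻¹W`, `e(πx_f) = π′(e_f x_f)`, charts injective, `e_f` onto the fine cube lattice, blocks preserved,
shift compatibilities inside the windows), the cuts' supports and fit, and the cube's letters are DISPLAYED; nothing of [B6]∕[B9] asserted ((2.133) p. 247, (3.42)–(3.43)
pp. 397–398 cited as SHAPES).  NE2⁺ NOT PRINTED ∕ NOT proved for d = 4; N15 NOT discharged; K3⁷ OPEN; counts UNMOVED (typed 28∕28 · discharged 5∕27, A 5∕28); one finite 𝕋⁴
at fixed ε — NOT infinite volume, NOT OS on ℝ⁴, NOT a mass gap, NOT Clay; R4 closes the conditional finite-𝕋⁴ rung `BalabanLadder.UV` only.  Restate-immune (no Theses import).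
-/

set_option autoImplicit false

noncomputable section
open scoped BigOperators
open Finset

namespace Summit.QuantumFields.YangMills.BalabanUVNodes.N15.CurvedSpecies

open Literature.MathematicalPhysics.QuantumFieldTheory.Balaban1983to89
open Literature.MathematicalPhysics.QuantumFieldTheory.Balaban1983to89.B11SectG (BlockNorm HasMaj)
open Literature.MathematicalPhysics.QuantumFieldTheory.Balaban1983to89.B6Prop26ReachTransplant (restrictOp extendOp transplant)
open Literature.MathematicalPhysics.QuantumFieldTheory.Balaban1983to89.B6Prop26Gluing (mulOp mulOp_apply)
open Literature.MathematicalPhysics.QuantumFieldTheory.Balaban1983to89.T4EtaRateDefect (idef idef_comp)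
open Literature.MathematicalPhysics.QuantumFieldTheory.Balaban1983to89.T4EtaRateCoeffDefect (pull pull_apply diagK diagK_nonneg hasMaj_idef_mulOp)
open Summit.QuantumFields.YangMills.BalabanUVNodes.N15.BackgroundLayer (fgrad bgrad)
open Summit.QuantumFields.YangMills.BalabanUVNodes.N15.Gluing (hasMaj_diag_comp)

variable {X X' Xf Xf' : Type} [Fintype X] [Fintype X'] [Fintype Xf] [Fintype Xf'] [DecidableEq X] [DecidableEq X'] [DecidableEq Xf] [DecidableEq Xf']
variable (W : Finset X) (e : X → X') (Wf : Finset Xf) (ef : Xf → Xf') (π : Xf → X) (π' : Xf' → X')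
variable (E : X ≃ X) (E' : X' ≃ X') (Ef : Xf ≃ Xf) (Ef' : Xf' ≃ Xf') (n nf : ℝ) (T : Module.End ℝ (X' → ℝ)) (Tf : Module.End ℝ (Xf' → ℝ))

/-! ## §1 The exact identity: cut derivative rows at two spacings = transplanted cube defect + fit of the cuts -/

section Identity

omit [Fintype X] [Fintype X'] [Fintype Xf] [Fintype Xf'] in
/-- ★★ **THE CUT FORWARD-DERIVATIVE ROWS OF TRANSPLANTED CUBE OPERATORS AT TWO SPACINGS, EXACT.**  Coarse data `(W, e, E, E′, n, T, h)`, fine data `(W_f, e_f, E_f, E_f′, n_f, T′, h′)`,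
two-grid maps `π : X_f → X`, `π′ : X_f′ → X′`; file 2's cut hypotheses on both grids (`h = 0` on `{x ∉ W} ∪ {Ex ∉ W}`, `h′ = 0` on `{x ∉ W_f} ∪ {E_fx ∉ W_f}`, shift∕chart compatibility
inside the windows) and file 11's window∕chart compatibilities (`x_f ∈ W_f ↔ πx_f ∈ W`, `e(πx_f) = π′(e_fx_f)` on `W_f`, charts injective, `e_f` onto `X_f′`).  Then
`𝔇(M_{h′}∇^{n_f}_{E_f}(ε_fT′ρ_f), M_h∇^n_E(εTρ)) = M_{h′} ∘ ε_f ∘ 𝔇_□(∇^{n_f}_{E_f′}T′, ∇^n_{E′}T) ∘ ρ + 𝔇(M_{h′}, M_h) ∘ ε(∇^n_{E′}T)ρ` (`𝔇 = idef (pull π) (pull π)`, `𝔇_□ = idef (pull π′) (pull π′)`).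
[cite: Balaban1984PropagatorsII, (2.133) p.247 (shape); Balaban1985BackgroundPropagators, Thm 3.1 (3.42)–(3.43) pp.397–398 (η-rate of the derivative entries: shape)] -/
theorem idef_mulOp_fgrad_transplant (hinj : Set.InjOn e ↑W) (hinjf : Set.InjOn ef ↑Wf) (hsurjf : ∀ xf', ∃ xf ∈ Wf, ef xf = xf')
    (hW : ∀ xf, xf ∈ Wf ↔ π xf ∈ W) (hcompatπ : ∀ xf ∈ Wf, e (π xf) = π' (ef xf))
    (hcompat : ∀ x ∈ W, E x ∈ W → e (E x) = E' (e x)) (hcompatf : ∀ xf ∈ Wf, Ef xf ∈ Wf → ef (Ef xf) = Ef' (ef xf))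
    {h : X → ℝ} (hh : ∀ x, (x ∉ W ∨ E x ∉ W) → h x = 0) {hf : Xf → ℝ} (hhf : ∀ xf, (xf ∉ Wf ∨ Ef xf ∉ Wf) → hf xf = 0) :
    idef (pull π) (pull π) (mulOp hf ∘ₗ (fgrad nf Ef ∘ₗ transplant Wf ef Tf)) (mulOp h ∘ₗ (fgrad n E ∘ₗ transplant W e T)) =
      mulOp hf ∘ₗ (extendOp Wf ef ∘ₗ idef (pull π') (pull π') (fgrad nf Ef' ∘ₗ Tf) (fgrad n E' ∘ₗ T) ∘ₗ restrictOp W e) +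
        idef (pull π) (pull π) (mulOp hf) (mulOp h) ∘ₗ transplant W e (fgrad n E' ∘ₗ T) := by
  rw [mulOp_comp_fgrad_comp_transplant W e E E' n T hcompat hh, mulOp_comp_fgrad_comp_transplant Wf ef Ef Ef' nf Tf hcompatf hhf,
    idef_comp (pull π) (pull π) (pull π) (mulOp hf) (transplant Wf ef (fgrad nf Ef' ∘ₗ Tf)) (mulOp h) (transplant W e (fgrad n E' ∘ₗ T)),
    idef_transplant W e Wf ef π π' hinj hinjf hsurjf hW hcompatπ]

omit [Fintype X] [Fintype X'] [Fintype Xf] [Fintype Xf'] in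
/-- ★★ **THE CUT BACKWARD-DERIVATIVE ROWS AT TWO SPACINGS, EXACT** (same, with file 2's backward cut hypotheses `h = 0` on `{x ∉ W} ∪ {E⁻¹x ∉ W}` etc.).
[cite: Balaban1984PropagatorsII, (2.133) p.247 (shape); Balaban1985BackgroundPropagators, (3.52) p.400, Thm 3.1 (3.42)–(3.43) pp.397–398 (shapes)] -/
theorem idef_mulOp_bgrad_transplant (hinj : Set.InjOn e ↑W) (hinjf : Set.InjOn ef ↑Wf) (hsurjf : ∀ xf', ∃ xf ∈ Wf, ef xf = xf')
    (hW : ∀ xf, xf ∈ Wf ↔ π xf ∈ W) (hcompatπ : ∀ xf ∈ Wf, e (π xf) = π' (ef xf))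
    (hcompat : ∀ x ∈ W, E x ∈ W → e (E x) = E' (e x)) (hcompatf : ∀ xf ∈ Wf, Ef xf ∈ Wf → ef (Ef xf) = Ef' (ef xf))
    {h : X → ℝ} (hh : ∀ x, (x ∉ W ∨ E.symm x ∉ W) → h x = 0) {hf : Xf → ℝ} (hhf : ∀ xf, (xf ∉ Wf ∨ Ef.symm xf ∉ Wf) → hf xf = 0) :
    idef (pull π) (pull π) (mulOp hf ∘ₗ (bgrad nf Ef ∘ₗ transplant Wf ef Tf)) (mulOp h ∘ₗ (bgrad n E ∘ₗ transplant W e T)) =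
      mulOp hf ∘ₗ (extendOp Wf ef ∘ₗ idef (pull π') (pull π') (bgrad nf Ef' ∘ₗ Tf) (bgrad n E' ∘ₗ T) ∘ₗ restrictOp W e) +
        idef (pull π) (pull π) (mulOp hf) (mulOp h) ∘ₗ transplant W e (bgrad n E' ∘ₗ T) := by
  rw [mulOp_comp_bgrad_comp_transplant W e E E' n T hcompat hh, mulOp_comp_bgrad_comp_transplant Wf ef Ef Ef' nf Tf hcompatf hhf,
    idef_comp (pull π) (pull π) (pull π) (mulOp hf) (transplant Wf ef (bgrad nf Ef' ∘ₗ Tf)) (mulOp h) (transplant W e (bgrad n E' ∘ₗ T)),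
    idef_transplant W e Wf ef π π' hinj hinjf hsurjf hW hcompatπ]

end Identity

/-! ## §2 The letters: transplanted cube defect + fit × transplanted coarse entry -/

section Majorant

variable {g : B6.Geometry} (blk : X → g.Site) (blk' : X' → g.Site) (blkf' : Xf' → g.Site)

/-- ★★ **THE LETTER OF THE CUT FORWARD-DERIVATIVE ROWS AT TWO SPACINGS.**  Fine global blocks `B ∘ π`; cube letters: the defect pair `𝔇_□(∇′_□T′, ∇_□T) ≤ K_𝔇` (cube blocks `B′` →
`B_f′`) and the coarse entry-1 `∇_□T ≤ K₁`; the cuts with `|h′| ≤ 1` and the two-grid fit `|h′(x_f) − h(πx_f)| ≤ o(B(πx_f))`.  Then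
`𝔇(M_{h′}∇′(ε_fT′ρ_f), M_h∇(εTρ)) ≤ 1_{W_f}(y)·1_W(y′)·K_𝔇(y, y′) + o(y)·1_W(y)·1_W(y′)·K₁(y, y′)` — the per-cube `hDG`-type input of the two-grid gluing for a transplanted cube, at the
cut derivative entry. [cite: Balaban1984PropagatorsII, (2.133) p.247 (shape); Balaban1985BackgroundPropagators, Thm 3.1 (3.42)–(3.43) pp.397–398 (shapes)] -/
theorem hasMaj_idef_mulOp_fgrad_transplant (hinj : Set.InjOn e ↑W) (hinjf : Set.InjOn ef ↑Wf) (hsurjf : ∀ xf', ∃ xf ∈ Wf, ef xf = xf')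
    (hW : ∀ xf, xf ∈ Wf ↔ π xf ∈ W) (hcompatπ : ∀ xf ∈ Wf, e (π xf) = π' (ef xf))
    (hcompat : ∀ x ∈ W, E x ∈ W → e (E x) = E' (e x)) (hcompatf : ∀ xf ∈ Wf, Ef xf ∈ Wf → ef (Ef xf) = Ef' (ef xf))
    (hblk : ∀ x ∈ W, blk' (e x) = blk x) (hblkf : ∀ xf ∈ Wf, blkf' (ef xf) = (blk ∘ π) xf)
    {h : X → ℝ} (hh : ∀ x, (x ∉ W ∨ E x ∉ W) → h x = 0) {hf : Xf → ℝ} (hhf : ∀ xf, (xf ∉ Wf ∨ Ef xf ∉ Wf) → hf xf = 0) (hhf1 : ∀ xf, |hf xf| ≤ 1)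
    {o : g.Site → ℝ} (ho : ∀ y, 0 ≤ o y) (hfit : ∀ xf, |hf xf - h (π xf)| ≤ o (blk (π xf)))
    {KD K₁ : g.Site → g.Site → ℝ} (hKD : ∀ a b, 0 ≤ KD a b) (hK₁ : ∀ a b, 0 ≤ K₁ a b)
    (hDD : HasMaj (BlockNorm.ofBlocks g blk') (BlockNorm.ofBlocks g blkf') (idef (pull π') (pull π') (fgrad nf Ef' ∘ₗ Tf) (fgrad n E' ∘ₗ T)) KD)
    (hD : HasMaj (BlockNorm.ofBlocks g blk') (BlockNorm.ofBlocks g blk') (fgrad n E' ∘ₗ T) K₁) :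
    HasMaj (BlockNorm.ofBlocks g blk) (BlockNorm.ofBlocks g (blk ∘ π))
      (idef (pull π) (pull π) (mulOp hf ∘ₗ (fgrad nf Ef ∘ₗ transplant Wf ef Tf)) (mulOp h ∘ₗ (fgrad n E ∘ₗ transplant W e T)))
      (fun y y' => windowInd Wf (blk ∘ π) y * windowInd W blk y' * KD y y' + o y * (windowInd W blk y * windowInd W blk y' * K₁ y y')) := by
  rw [idef_mulOp_fgrad_transplant W e Wf ef π π' E E' Ef Ef' n nf T Tf hinj hinjf hsurjf hW hcompatπ hcompat hcompatf hh hhf]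
  refine HasMaj.add ?_ ?_
  · exact hasMaj_mulOp_comp_of_abs_le_one' (blk ∘ π) hhf1 (fun y y' => mul_nonneg (mul_nonneg (windowInd_nonneg _ _ _) (windowInd_nonneg _ _ _)) (hKD y y'))
      (hasMaj_extend_comp_restrict W e blk blk' Wf ef (blk ∘ π) blkf' hinj hblk hblkf hKD hDD)
  · exact hasMaj_diag_comp blk ho (hasMaj_idef_mulOp blk π ho hfit)
      (hasMaj_transplant W e blk blk' hinj hblk hK₁ hD)

/-- ★★ **THE LETTER OF THE CUT BACKWARD-DERIVATIVE ROWS AT TWO SPACINGS** (same letters, backward cut hypotheses). [cite: Balaban1984PropagatorsII, (2.133) p.247 (shape); Balaban1985BackgroundPropagators, (3.52) p.400, Thm 3.1 (3.42)–(3.43) pp.397–398 (shapes)] -/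
theorem hasMaj_idef_mulOp_bgrad_transplant (hinj : Set.InjOn e ↑W) (hinjf : Set.InjOn ef ↑Wf) (hsurjf : ∀ xf', ∃ xf ∈ Wf, ef xf = xf')
    (hW : ∀ xf, xf ∈ Wf ↔ π xf ∈ W) (hcompatπ : ∀ xf ∈ Wf, e (π xf) = π' (ef xf))
    (hcompat : ∀ x ∈ W, E x ∈ W → e (E x) = E' (e x)) (hcompatf : ∀ xf ∈ Wf, Ef xf ∈ Wf → ef (Ef xf) = Ef' (ef xf))
    (hblk : ∀ x ∈ W, blk' (e x) = blk x) (hblkf : ∀ xf ∈ Wf, blkf' (ef xf) = (blk ∘ π) xf)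
    {h : X → ℝ} (hh : ∀ x, (x ∉ W ∨ E.symm x ∉ W) → h x = 0) {hf : Xf → ℝ} (hhf : ∀ xf, (xf ∉ Wf ∨ Ef.symm xf ∉ Wf) → hf xf = 0) (hhf1 : ∀ xf, |hf xf| ≤ 1)
    {o : g.Site → ℝ} (ho : ∀ y, 0 ≤ o y) (hfit : ∀ xf, |hf xf - h (π xf)| ≤ o (blk (π xf)))
    {KD K₁ : g.Site → g.Site → ℝ} (hKD : ∀ a b, 0 ≤ KD a b) (hK₁ : ∀ a b, 0 ≤ K₁ a b)
    (hDD : HasMaj (BlockNorm.ofBlocks g blk') (BlockNorm.ofBlocks g blkf') (idef (pull π') (pull π') (bgrad nf Ef' ∘ₗ Tf) (bgrad n E' ∘ₗ T)) KD)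
    (hD : HasMaj (BlockNorm.ofBlocks g blk') (BlockNorm.ofBlocks g blk') (bgrad n E' ∘ₗ T) K₁) :
    HasMaj (BlockNorm.ofBlocks g blk) (BlockNorm.ofBlocks g (blk ∘ π))
      (idef (pull π) (pull π) (mulOp hf ∘ₗ (bgrad nf Ef ∘ₗ transplant Wf ef Tf)) (mulOp h ∘ₗ (bgrad n E ∘ₗ transplant W e T)))
      (fun y y' => windowInd Wf (blk ∘ π) y * windowInd W blk y' * KD y y' + o y * (windowInd W blk y * windowInd W blk y' * K₁ y y')) := by
  rw [idef_mulOp_bgrad_transplant W e Wf ef π π' E E' Ef Ef' n nf T Tf hinj hinjf hsurjf hW hcompatπ hcompat hcompatf hh hhf]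
  refine HasMaj.add ?_ ?_
  · exact hasMaj_mulOp_comp_of_abs_le_one' (blk ∘ π) hhf1 (fun y y' => mul_nonneg (mul_nonneg (windowInd_nonneg _ _ _) (windowInd_nonneg _ _ _)) (hKD y y'))
      (hasMaj_extend_comp_restrict W e blk blk' Wf ef (blk ∘ π) blkf' hinj hblk hblkf hKD hDD)
  · exact hasMaj_diag_comp blk ho (hasMaj_idef_mulOp blk π ho hfit)
      (hasMaj_transplant W e blk blk' hinj hblk hK₁ hD)

end Majorant

end Summit.QuantumFields.YangMills.BalabanUVNodes.N15.CurvedSpecies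

end
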